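import Summits.QuantumFields.YangMills.Theorems.BalabanUVNodesN21ChartExponentAnalyticU1
import Summits.QuantumFields.YangMills.Theorems.BalabanUVNodesN21ChartExponentConvexityLocal

/-!
# N21 (NE7c) · THE `U(1)` MODEL INSTANCE OF THE ANALYTIC ROAD, LOCAL FORM: ★★★ WITHOUT THE DIAMETER BINDER (dag-n21-w3
# g4's ★★′-loc `convexOn_expansion_of_analyticSupBound_local` FED BY NAME), and the rate comparison at a FREE width

Width seat pub-ymgap-dag-n21-w5 (g2; director-ym R399 (3a) ∕ №209 second wave, dag-lead WIDTH-209), node N21 = NE7c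
(single-run shell-weight bound, NOT PRINTED in [Bałaban 1983–89], NOT proved), lane K3⁷ `SpineGivenEndpointR13SepCoPH`
(stmt-QuantumFields-20544, `--kind proof --supports … --as helper`).  FILE 3c of the located hand «P2-U1A» (pen
dag-n21-w3; this seat's INTENT-5): the `_local` twin of p610142 ★★★ `N21ChartExponentAnalyticU1.convexOn_chartExponentU1_analytic`,
which displayed `hdiam : ∀ x y ∈ K, ‖y − x‖ < r` (dag-n21-w3 g4's p611900 header lists it among the consumers doing so).

THE POINT.  dag-n21-w3 g4 (p611900 `…N21ChartExponentConvexityLocal`) made the analytic road LOCAL: Cauchy's estimate for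
the SECOND derivative along chart lines needs analyticity + a value row on the `r`-balls about each real point only, for
ANY `r > 0`, with the clause `4·d·(100M)^{d+1}·S ≤ γ₀·r²` (constant 4, was 16) and no relation between `r` and the size of
the kept cut.  For the abelian lattice action the complexified (1.2) remainder is ENTIRE (p610142 §2), so every width `r`
is admissible and the sup letter `S(g, Φ, r) = g·(Φ + c_H r)³·e^{g(Φ + c_H r)}·Z` (p610142 ★★) feeds ★★′-loc directly:
* §1 ★★★-loc `convexOn_chartExponentU1_analytic_local`: the abelian (1.2) exponent
  `c + ½·v ⬝ᵥ (A *ᵥ v) + ℓ v + g⁻²·V12 g ζ θ (H *ᵥ v)` is CONVEX on ANY convex window with `|(H *ᵥ v)_p| ≤ Φ` under (1.9)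
  `∀ v` and `4·d·(100M)^{d+1}·S(g, Φ, r) ≤ γ₀·r²` for ANY `r > 0` — p610142 ★★★ MINUS `hdiam` and MINUS `hγ₀`;
* §2 THE RATE COMPARISON IN LOCAL FORM: the comparable letters are `S∕r²` (local analytic clause
  `4d(100M)^{d+1}·(S∕r²) ≤ γ₀`) and the hand-computed real row `g·Φ·c_φ`, `c_φ = Z·c_H²` (p606810 ∕ p607837 ∕ p612065 §4,
  clause `4d(100M)^{d+1}·(gΦc_φ) ≤ γ₀`): at the width `r = Φ∕c_H` one has EXACTLY `S∕r² = 8·e^{2gΦ}·(g·Φ·Z·c_H²)`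
  (`analyticLetterLocal_eq`), `≤ 8e·(g·Φ·Z·c_H²)` under the real road's cap `2gΦ ≤ 1`; hence the REAL road's clause WITH
  ROOM `8e ≈ 21.7` implies the local analytic clause (`localClause_of_realClauseWithRoom`) — same rate `g¹·Φ`, no diameter
  letter anywhere, half the global road's factor `16·e^{2gΦ}` (p612065 `cauchyLetter_eq`);
* §3 A6 (№189 (3)): every binder of ★★★-loc JOINTLY INHABITED by the one-plaquette lattice cosine action with a width
  `r = 1` SMALLER than the diameter `2` of the window `B̄₁(0)` — a datum the global road (p610142 ★★★, `hdiam`) could not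
  take (`g = 1∕100`; clause `4·S(1∕100, 1, 1) = 4·(8∕100)·e^{1∕50} ≤ 1`).

HONEST FRAMING.  [textbook] real inequalities + composition BY NAME (p611900 ★★′-loc; p610142 §2) over the tree's `U(1)`
MODEL INSTANCE (abelian: no `D₃`∕BCH terms of [Balaban1987RG1] (2.6)–(2.7)); the identification of
`(ζ₀, θ, H = ∂H_{1,k}, Φ ≤ K·p₀(g_k), r, Z, c_H)` with [LF-II] (1.2)'s members ∕ print's analyticity width is LOCATED typing,
NOT asserted; print states the VALUE row on the real chart only; nothing of Bałaban's asserted; (M1) ∕ NE7c NOT PRINTED ∕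
NOT proved; N21 NOT discharged; K3⁷ NOT claimed; counts unmoved (typed 28∕28 · discharged 5∕27); count-neutral; one
finite 𝕋⁴ at fixed ε — R4 would close only the conditional finite-𝕋⁴ rung `BalabanLadder.UV`, NOT the Yang–Mills mass gap
(Clay); nothing about ℝ⁴ ∕ OS.  THEOREMS ONLY: 0 `def`, 0 `sorry`.
-/

set_option autoImplicit false

open Real Finset Set Matrix Metric

namespace Summit.QuantumFields.YangMills.Theorems.N21ChartExponentAnalyticU1Local

open Literature.MathematicalPhysics.QuantumFieldTheory.Balaban1983to89.B16Txt357ThirdOrderU1 (V12)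
open Literature.MathematicalPhysics.QuantumFieldTheory.Balaban1983to89.B16Sect1Wilson (Ineq19)
open Summit.QuantumFields.YangMills.Theorems.N21ChartExponentAnalyticU1
  (V12_complex_ofReal differentiable_V12_complex norm_V12_complex_le)
open Summit.QuantumFields.YangMills.Theorems.N21ChartExponentConvexityLocal
  (convexOn_expansion_of_analyticSupBound_local)

/-! ## §1  ★★★-loc Convexity of the abelian (1.2) exponent by the LOCAL analytic road — no diameter binder -/

section LocalRoad

variable {κ : Type*} [Fintype κ] {ι : Type*} [Fintype ι]

/-- ★★★-loc **CONVEXITY OF THE ABELIAN (1.2) EXPONENT BY THE LOCAL ANALYTIC ROAD** (the `U(1)` MODEL INSTANCE of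
dag-n21-w3 g4's ★★′-loc `N21ChartExponentConvexityLocal.convexOn_expansion_of_analyticSupBound_local`).  On ANY convex
window `K ⊆ (κ → ℝ)` with `|(H *ᵥ v)_p| ≤ Φ` (`Φ ≥ 0`), the exponent
`φ v = c + ½·v ⬝ᵥ (A *ᵥ v) + ℓ v + g⁻²·V12 g ζ θ (H *ᵥ v)` is CONVEX under (1.9) for every `v` and the ONE clause
`4·d·(100M)^{d+1}·S(g, Φ, r) ≤ γ₀·r²`, `S = g·(Φ + c_H r)³·e^{g(Φ + c_H r)}·Z` (p610142 ★★), for ANY width `r > 0`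
(row-sum letter `Σ_b |H_{pb}| ≤ c_H`, `c_H ≥ 0`; `Σ_p ζ_p ≤ Z`, `ζ ≥ 0`).  p610142 ★★★ MINUS `hdiam` (and MINUS `hγ₀`):
the complexified remainder is ENTIRE, so the analyticity width is free of the window's size. [textbook] -/
theorem convexOn_chartExponentU1_analytic_local {K : Set (κ → ℝ)} (hK : Convex ℝ K) (φ : (κ → ℝ) → ℝ) (c : ℝ)
    (A : Matrix κ κ ℝ) (ℓ : (κ → ℝ) →ₗ[ℝ] ℝ) (H : Matrix ι κ ℝ) {ζ : ι → ℝ} (θ : ι → ℝ)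
    {g Φ cH Z r γ₀ M : ℝ} {d : ℕ}
    (hg : 0 < g) (hΦ : 0 ≤ Φ) (hcH : 0 ≤ cH) (hζ : ∀ p, 0 ≤ ζ p) (hZ : ∑ p, ζ p ≤ Z)
    (hH : ∀ p, ∑ b, |H p b| ≤ cH) (hd : 1 ≤ d) (hM : 0 < M) (hr : 0 < r)
    (hexp : ∀ v ∈ K, φ v = c + 1 / 2 * (v ⬝ᵥ (A *ᵥ v)) + ℓ v + 1 / g ^ 2 * V12 g ζ θ (H *ᵥ v))
    (h19 : ∀ v, Ineq19 (v ⬝ᵥ (A *ᵥ v)) (∑ b, v b ^ 2) γ₀ d M)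
    (hwin : ∀ v ∈ K, ∀ p, |(H *ᵥ v) p| ≤ Φ)
    (hclause : 4 * d * (100 * M) ^ (d + 1) * (g * (Φ + cH * r) ^ 3 * Real.exp (g * (Φ + cH * r)) * Z) ≤
      γ₀ * r ^ 2) :
    ConvexOn ℝ K φ := by
  refine convexOn_expansion_of_analyticSupBound_local hK φ (fun v => v ⬝ᵥ (A *ᵥ v)) (fun v => ℓ v)
    (fun v => 1 / g ^ 2 * V12 g ζ θ (H *ᵥ v)) c hexp A (fun _ => rfl) hd hM h19 ℓ (fun _ => rfl)
    (fun w => (1 / g ^ 2 : ℂ) * ∑ p, (ζ p : ℂ) *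
      ((Real.cos (θ p) : ℂ) * (1 - ((g : ℂ) * (H.map ((↑) : ℝ → ℂ) *ᵥ w) p) ^ 2 / 2
          - Complex.cos ((g : ℂ) * (H.map ((↑) : ℝ → ℂ) *ᵥ w) p))
        + (Real.sin (θ p) : ℂ) * (Complex.sin ((g : ℂ) * (H.map ((↑) : ℝ → ℂ) *ᵥ w) p)
          - (g : ℂ) * (H.map ((↑) : ℝ → ℂ) *ᵥ w) p)))
    (r := r) (S := g * (Φ + cH * r) ^ 3 * Real.exp (g * (Φ + cH * r)) * Z) hr ?_ ?_ ?_ hclause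
  · -- the real slice: `g⁻²V(H x) = Re (g⁻²Vℂ)(↑x)`
    intro x _
    rw [V12_complex_ofReal g ζ θ H _ (fun _ => rfl) x, Complex.ofReal_re]
  · -- entire, hence differentiable on every ball
    intro x _
    exact (differentiable_V12_complex g ζ θ H _ (fun _ => rfl)).differentiableOn
  · -- the sup letter on the `r`-ball about a real window point
    intro x hx u hu
    exact norm_V12_complex_le hg hΦ hcH hζ hZ θ H hH _ (fun _ => rfl) (hwin x hx) (mem_ball_iff_norm.1 hu).le

/-! ## §2  The rate comparison in local form: `S∕r²` at a free width vs the hand-computed real row `g·Φ·Z·c_H²` -/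

/-- **THE LOCAL ANALYTIC LETTER AT THE WINDOW RADIUS.**  At the width `r = Φ∕c_H` (`Φ, c_H > 0`), the local road's
letter `S(g, Φ, r)∕r²` for the abelian remainder is EXACTLY `8·e^{2gΦ}·(g·Φ·Z·c_H²)` — the hand-computed real row
`g·Φ·(Z c_H²)` (p606810 ∕ p607837, `c_φ = Z·c_H²` by p612065 `sum_sq_mulVec_le`) times `8·e^{2gΦ}`; half the global
road's `16·e^{2gΦ}` (p612065 `cauchyLetter_eq`). [textbook] -/
theorem analyticLetterLocal_eq {g Φ cH Z : ℝ} (hΦ : 0 < Φ) (hcH : 0 < cH) :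
    g * (Φ + cH * (Φ / cH)) ^ 3 * Real.exp (g * (Φ + cH * (Φ / cH))) * Z / (Φ / cH) ^ 2 =
      8 * Real.exp (2 * g * Φ) * (g * Φ * (Z * cH ^ 2)) := by
  have e : Φ + cH * (Φ / cH) = 2 * Φ := by field_simp; ring
  rw [e, show g * (2 * Φ) = 2 * g * Φ by ring]
  field_simp
  ring

/-- **SAME RATE, FACTOR `8e`**: under the real road's own cap `2gΦ ≤ 1`, the local analytic letter at `r = Φ∕c_H` is at
most `8e·(g·Φ·Z·c_H²)` (`8e ≈ 21.7`). [textbook] -/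
theorem analyticLetterLocal_le {g Φ cH Z : ℝ} (hg : 0 ≤ g) (hΦ : 0 < Φ) (hcH : 0 < cH) (hZ : 0 ≤ Z)
    (hcap : 2 * g * Φ ≤ 1) :
    g * (Φ + cH * (Φ / cH)) ^ 3 * Real.exp (g * (Φ + cH * (Φ / cH))) * Z / (Φ / cH) ^ 2 ≤
      8 * Real.exp 1 * (g * Φ * (Z * cH ^ 2)) := by
  rw [analyticLetterLocal_eq hΦ hcH]
  have h1 : Real.exp (2 * g * Φ) ≤ Real.exp 1 := Real.exp_le_exp.2 hcap
  have h0 : 0 ≤ g * Φ * (Z * cH ^ 2) := by positivity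
  exact mul_le_mul_of_nonneg_right (mul_le_mul_of_nonneg_left h1 (by norm_num)) h0

/-- **THE REAL ROAD's CLAUSE WITH ROOM `8e` IMPLIES THE LOCAL ANALYTIC CLAUSE.**  If the hand-computed road's clause holds
with the numerical room `8e`, `4·d·(100M)^{d+1}·(8e·g·Φ·Z·c_H²) ≤ γ₀` (and its cap `2gΦ ≤ 1`), then ★★★-loc's clause holds
at the width `r = Φ∕c_H`: «the analytic road costs a constant, not a rate» as an implication; no diameter letter anywhere.
[textbook] -/
theorem localClause_of_realClauseWithRoom {g Φ cH Z γ₀ M : ℝ} {d : ℕ} (hg : 0 ≤ g) (hΦ : 0 < Φ) (hcH : 0 < cH)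
    (hZ : 0 ≤ Z) (hM : 0 < M) (hcap : 2 * g * Φ ≤ 1)
    (hreal : 4 * d * (100 * M) ^ (d + 1) * (8 * Real.exp 1 * (g * Φ * (Z * cH ^ 2))) ≤ γ₀) :
    4 * d * (100 * M) ^ (d + 1) *
        (g * (Φ + cH * (Φ / cH)) ^ 3 * Real.exp (g * (Φ + cH * (Φ / cH))) * Z) ≤ γ₀ * (Φ / cH) ^ 2 := by
  have hr2 : 0 < (Φ / cH) ^ 2 := by positivity
  have key := analyticLetterLocal_le hg hΦ hcH hZ hcap
  rw [div_le_iff₀ hr2] at key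
  calc 4 * d * (100 * M) ^ (d + 1) * (g * (Φ + cH * (Φ / cH)) ^ 3 * Real.exp (g * (Φ + cH * (Φ / cH))) * Z)
      ≤ 4 * d * (100 * M) ^ (d + 1) * (8 * Real.exp 1 * (g * Φ * (Z * cH ^ 2)) * (Φ / cH) ^ 2) :=
        mul_le_mul_of_nonneg_left key (by positivity)
    _ = 4 * d * (100 * M) ^ (d + 1) * (8 * Real.exp 1 * (g * Φ * (Z * cH ^ 2))) * (Φ / cH) ^ 2 := by ring
    _ ≤ γ₀ * (Φ / cH) ^ 2 := mul_le_mul_of_nonneg_right hreal hr2.le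

/-- ★★★-loc′ **THE LOCAL ROAD AT THE WINDOW RADIUS, FED BY THE REAL ROAD's CLAUSE WITH ROOM**: on a convex window with
`|(H *ᵥ v)_p| ≤ Φ` (`Φ, c_H > 0`), under (1.9) ∀ v, the cap `2gΦ ≤ 1` and `4·d·(100M)^{d+1}·(8e·g·Φ·Z·c_H²) ≤ γ₀`, the
abelian (1.2) exponent is CONVEX — ★★★-loc at `r = Φ∕c_H` with `localClause_of_realClauseWithRoom`. [textbook] -/
theorem convexOn_chartExponentU1_analytic_local_realRoom {K : Set (κ → ℝ)} (hK : Convex ℝ K) (φ : (κ → ℝ) → ℝ)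
    (c : ℝ) (A : Matrix κ κ ℝ) (ℓ : (κ → ℝ) →ₗ[ℝ] ℝ) (H : Matrix ι κ ℝ) {ζ : ι → ℝ} (θ : ι → ℝ)
    {g Φ cH Z γ₀ M : ℝ} {d : ℕ}
    (hg : 0 < g) (hΦ : 0 < Φ) (hcH : 0 < cH) (hζ : ∀ p, 0 ≤ ζ p) (hZ : ∑ p, ζ p ≤ Z) (hZ0 : 0 ≤ Z)
    (hH : ∀ p, ∑ b, |H p b| ≤ cH) (hd : 1 ≤ d) (hM : 0 < M)
    (hexp : ∀ v ∈ K, φ v = c + 1 / 2 * (v ⬝ᵥ (A *ᵥ v)) + ℓ v + 1 / g ^ 2 * V12 g ζ θ (H *ᵥ v))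
    (h19 : ∀ v, Ineq19 (v ⬝ᵥ (A *ᵥ v)) (∑ b, v b ^ 2) γ₀ d M)
    (hwin : ∀ v ∈ K, ∀ p, |(H *ᵥ v) p| ≤ Φ) (hcap : 2 * g * Φ ≤ 1)
    (hreal : 4 * d * (100 * M) ^ (d + 1) * (8 * Real.exp 1 * (g * Φ * (Z * cH ^ 2))) ≤ γ₀) :
    ConvexOn ℝ K φ :=
  convexOn_chartExponentU1_analytic_local hK φ c A ℓ H θ hg hΦ.le hcH.le hζ hZ hH hd hM (by positivity) hexp h19
    hwin (localClause_of_realClauseWithRoom hg.le hΦ hcH hZ0 hM hcap hreal)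

end LocalRoad

/-! ## §3  A6 witness: ★★★-loc fires with an analyticity width SMALLER than the window's diameter -/

section Witness

/-- **A6 WITNESS OF ★★★-loc** (director-ym STANDING A6 RULE №189 (3)): one bond ∕ one plaquette (`κ = ι = Fin 1`), chart
`H = 1`, `A = 1`, `ℓ = 0`, `c = 0`, weight `ζ = 1` (`Z = 1`), background `θ = 0`, `g = 1∕100`, window `K = B̄₁(0)`
(`Φ = 1`, `c_H = 1`; diameter `2`), and the width `r = 1` — SMALLER than the diameter, so p610142's global ★★★ (`hdiam`)
could not take this datum; rows at `γ₀ = 1`, `d = 1`, `M = 1∕100`; the clause `4·S(1∕100, 1, 1) = (32∕100)·e^{1∕50} ≤ 1`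
holds (`e^{1∕50} ≤ e < 3`).  ★★★-loc fires: the one-plaquette action `½(v ⬝ᵥ v) + 100²·V12 (1∕100) 1 0 v` is CONVEX on
the closed unit ball.  A satisfiability witness, not an estimate on Bałaban's measure. [textbook] -/
theorem chartExponentU1_analytic_local_letters_inhabited :
    ConvexOn ℝ (closedBall (0 : Fin 1 → ℝ) 1) (fun v : Fin 1 → ℝ =>
      1 / 2 * (v ⬝ᵥ v) + 1 / (1 / 100) ^ 2 * V12 (1 / 100) (fun _ : Fin 1 => (1 : ℝ)) (fun _ => 0) v) := by
  refine convexOn_chartExponentU1_analytic_local (ι := Fin 1) (convex_closedBall _ _) _ 0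
    (1 : Matrix (Fin 1) (Fin 1) ℝ) 0 (1 : Matrix (Fin 1) (Fin 1) ℝ) (ζ := fun _ => 1) (fun _ => 0) (g := 1 / 100)
    (Φ := 1) (cH := 1) (Z := 1) (r := 1) (γ₀ := 1) (M := 1 / 100) (d := 1) (by norm_num) zero_le_one zero_le_one
    (fun _ => zero_le_one) (by simp) ?_ le_rfl (by norm_num) one_pos ?_ ?_ ?_ ?_
  · -- hH: the row sum of the `1 × 1` identity matrix is `1`
    intro p
    obtain rfl : p = 0 := Subsingleton.elim p 0
    rw [Fin.sum_univ_one, Matrix.one_apply_eq, abs_one]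
  · -- hexp
    intro v _
    rw [Matrix.one_mulVec, LinearMap.zero_apply]
    ring
  · -- h19 (1.9) as a real inequality: `1∕(2·1·1²)·Σ_b v_b² ≤ v ⬝ᵥ v`
    intro v
    unfold Ineq19
    rw [Matrix.one_mulVec]
    simp only [dotProduct, Fin.sum_univ_one, Nat.cast_one]
    norm_num
    nlinarith [sq_nonneg (v 0)]
  · -- hwin: `|(1 *ᵥ v)_p| = |v_p| ≤ ‖v‖ ≤ 1` on the closed unit ball
    intro v hv p
    rw [Matrix.one_mulVec]
    have h1 : ‖v p‖ ≤ ‖v‖ := norm_le_pi_norm v p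
    rw [Real.norm_eq_abs] at h1
    exact h1.trans (mem_closedBall_zero_iff.mp hv)
  · -- the clause: `4·1·1²·((1∕100)·2³·e^{2∕100}·1) ≤ 1·1²`, from `e^{1∕50} ≤ e ≤ 3`
    have he : Real.exp (1 / 100 * (1 + 1 * 1)) ≤ 3 :=
      (Real.exp_le_exp.2 (by norm_num)).trans (Real.exp_one_lt_d9.le.trans (by norm_num))
    have h0 : 0 ≤ Real.exp (1 / 100 * (1 + 1 * 1)) := Real.exp_nonneg _
    norm_num at he h0 ⊢
    nlinarith

end Witness

end Summit.QuantumFields.YangMills.Theorems.N21ChartExponentAnalyticU1Local
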